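import Mathlib

/-!
# Line `sector-split` of crux `RigidCore.SchanuelOnLogFreeCore`: the conjugate-norm transfer
# device (stub C1 of skeleton v13 "conjugate norms")

Crux `stmt-Schanuel-0970` (`Summit.Schanuel.Schanuel.Theses.RigidCore.SchanuelOnLogFreeCore`,
Schanuel's conjecture for `ℚ`-free tuples from the log-free core), line `sector-split`,
skeleton v13, registered calibration stub `stub_conjNormTransfer`.  This file is the DEVICE
itself, recording what complex conjugation applied to VALUES extracts: for an intermediate field
`F ≤ ℂ` (over `ℚ`) stable under complex conjugation, if `e^u` is algebraic over `F` then so are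

* the conjugate norm `|e^u|² = e^u · conj (e^u) = e^{u + ū} = e^{2 Re u}`, and
* the conjugate ratio `e^u / conj (e^u) = e^{u − ū} = e^{2 i Im u}`.

Proof: complex conjugation restricts to an (injective) ring endomorphism `σ : F →+* F`, and a
nonzero polynomial over `F` killing `y` has its coefficient-conjugate (nonzero) killing `conj y`;
Mathlib packages this as `IsAlgebraic.ringHom_of_comp_eq` (`ConjNorm.isAlgebraic_conj`).  With
`Complex.exp_conj : exp (conj u) = conj (exp u)` the element `e^{ū}` is algebraic over `F`, and
algebraic elements over a field are closed under `*` and `⁻¹` (`IsAlgebraic.mul`,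
`IsAlgebraic.inv`); finally `u + ū = 2 Re u` (`Complex.add_conj`) and `u − ū = 2 i Im u`
(`Complex.sub_conj`).

NOT here: no cells of the sector split (the rank-`2` cell `(πi, u)`, the `π ⊥ e^u` independence
for `Re u ∈ ℚπ ∪ ℚπ√3`, the transcendence of `e^u` over on-axes Lindemann–Weierstrass fields —
those are stubs C2–C4 of skeleton v13, in sibling modules), and nothing about the two open-problem
residues of the line.

## References

* [Diaz2004] G. Diaz, *Utilisation de la conjugaison complexe dans l'étude de la transcendance de
  valeurs de la fonction exponentielle usuelle*, J. Théor. Nombres Bordeaux 16 (2004) 535–553,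
  doi:10.5802/jtnb.459 — the conjugation device (`|e^u|²`, `e^u / conj e^u`).
-/

noncomputable section

-- `Summit.Schanuel.Schanuel.…` is the D-0017 single-problem layout
set_option linter.dupNamespace false

namespace Summit.Schanuel.Schanuel.Theorems.RigidCore

namespace ConjNorm

/-- Transport of algebraicity along complex conjugation: if the intermediate field `F ≤ ℂ` is
stable under `conj` and `y` is algebraic over `F`, then so is `conj y` (conjugate the
coefficients of an annihilating polynomial; `IsAlgebraic.ringHom_of_comp_eq` for the restricted
endomorphism `σ = conj|F : F →+* F` and `g = conj`). [folklore] -/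
theorem isAlgebraic_conj {F : IntermediateField ℚ ℂ} (hF : ∀ z ∈ F, (starRingEnd ℂ) z ∈ F)
    {y : ℂ} (hy : IsAlgebraic F y) : IsAlgebraic F ((starRingEnd ℂ) y) := by
  let σ : F →+* F :=
    { toFun := fun x => ⟨(starRingEnd ℂ) x, hF x x.2⟩
      map_one' := Subtype.ext (map_one _)
      map_mul' := fun a b => Subtype.ext (map_mul _ _ _)
      map_zero' := Subtype.ext (map_zero _)
      map_add' := fun a b => Subtype.ext (map_add _ _ _) }
  have hσ : Function.Injective σ := fun a b h =>
    Subtype.ext ((starRingEnd ℂ).injective (congrArg Subtype.val h))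
  exact hy.ringHom_of_comp_eq σ (starRingEnd ℂ) hσ (RingHom.ext fun _ => rfl)

/-- If `F ≤ ℂ` is stable under `conj` and `e^u` is algebraic over `F`, then so is
`e^{ū} = conj (e^u)` (`Complex.exp_conj` + `isAlgebraic_conj`). [folklore] -/
theorem isAlgebraic_exp_conj {F : IntermediateField ℚ ℂ} (hF : ∀ z ∈ F, (starRingEnd ℂ) z ∈ F)
    {u : ℂ} (hu : IsAlgebraic F (Complex.exp u)) :
    IsAlgebraic F (Complex.exp ((starRingEnd ℂ) u)) := by
  rw [Complex.exp_conj]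
  exact isAlgebraic_conj hF hu

/-- `2 Re u = u + ū` as complex numbers (`Complex.add_conj`). [folklore] -/
theorem two_mul_re_eq (u : ℂ) : (2 * (u.re : ℂ)) = u + (starRingEnd ℂ) u := by
  rw [Complex.add_conj]
  push_cast
  ring

/-- `2 i Im u = u − ū` as complex numbers (`Complex.sub_conj`). [folklore] -/
theorem two_mul_im_mul_I_eq (u : ℂ) :
    (2 * (u.im : ℂ) * Complex.I) = u - (starRingEnd ℂ) u := by
  rw [Complex.sub_conj]
  push_cast
  ring

end ConjNorm

/-- **Conjugate-norm transfer** (stub C1 of skeleton v13 of line `sector-split`, crux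
`stmt-Schanuel-0970`).  For an intermediate field `F ≤ ℂ` over `ℚ` stable under complex
conjugation and any `u : ℂ`: if `e^u` is algebraic over `F`, then so are the conjugate norm
`e^{2 Re u} = e^u · conj (e^u)` and the conjugate ratio `e^{2 i Im u} = e^u / conj (e^u)`.
[folklore] -/
theorem stub_conjNormTransfer :
    ∀ (F : IntermediateField ℚ ℂ), (∀ z ∈ F, (starRingEnd ℂ) z ∈ F) →
      ∀ u : ℂ, IsAlgebraic F (Complex.exp u) →
        IsAlgebraic F (Complex.exp (2 * (u.re : ℂ))) ∧
          IsAlgebraic F (Complex.exp (2 * (u.im : ℂ) * Complex.I)) := by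
  intro F hF u hu
  have hc : IsAlgebraic F (Complex.exp ((starRingEnd ℂ) u)) := ConjNorm.isAlgebraic_exp_conj hF hu
  refine ⟨?_, ?_⟩
  · rw [ConjNorm.two_mul_re_eq, Complex.exp_add]
    exact hu.mul hc
  · rw [ConjNorm.two_mul_im_mul_I_eq, Complex.exp_sub, div_eq_mul_inv]
    exact hu.mul hc.inv

end Summit.Schanuel.Schanuel.Theorems.RigidCore
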